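import Literature.AlgebraicGeometry.Morphisms.ArtinianLiftsOfSmoothRestrict
import HarnessLib

/-!
# Crux `HLiu418` — P6 sub-line **F0-P6d LubinTateFormalModuli**, stub (5b) `StubL4B5bStatement` (socket (b-0)) PAID

Cell `hodgecm-mathlib`, P6 «MOD programme» Row 4B, line `Cruxes/HLiu418/Lines/F0_P6d_LubinTateFormalModuli.lean`
(F0P6d-plan (g0), ED. 2, tree sha16 `b61911ed76ed3d88`), registered stub (5b) `stub_L4B5b : StubL4B5bStatement` (§2¾ socket (b-0)
«lifts where `p` is a unit, from `Smooth (ω ∣_ S[1/p])`», :260–:261 and :321 of the line).  This file proves THE TEXT OF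
`StubL4B5bStatement` with the two line-local socket shapes `LiftsWherePUnit ω p := ArtinianLiftsWhere ω (fun A _ => IsUnit (p : A))`
(:242–:255) δ-UNFOLDED token for token (same binders, same universe `u`; nothing imports a `Cruxes/…/Lines` module), as the theorem
`stubL4B5bStatement`, so that the desk folds `stub_L4B5b := F0P6dStubL4B5b.stubL4B5bStatement` BY NAME at the next edition (the fold
elaborates by δ-reduction of `StubL4B5bStatement`, `LiftsWherePUnit`, `ArtinianLiftsWhere`; seat F0P6-p08 (g0) by-import CERT against the
tree ED. 2: rc 0, axioms {propext, Classical.choice, Quot.sound}).  The proof is the ★ Literature organ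
`Literature.AlgebraicGeometry.Morphisms.liftsWherePUnit_of_smooth_restrict_basicOpen` (`ArtinianLiftsOfSmoothRestrict.lean`, A-p03 (g27)):
an Artinian local point `a : Spec A ⟶ S` with `p ∈ Aˣ` lands in `S.basicOpen p` (`range_subset_basicOpen_of_isUnit_natCast`), `J² ⊆ 𝔪_A J = 0`,
and a smooth `ω ∣_ U` lifts local points landing in `U` along nilpotent surjections (`exists_lift_of_smooth_morphismRestrict`, [EGAIV4]
Prop. (17.1.6) with Déf. (17.3.1); [StacksProject] Tag 02H6).  HC_CM is proved only modulo the printed citations until rung 0 closes;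
nothing here is about HC — it discharges one registered stub of the P6d line.

## References
* [EGAIV4] A. Grothendieck, J. Dieudonné, *Éléments de géométrie algébrique* IV₄, Publ. Math. IHÉS 32 (1967), Déf. (17.1.1), Prop. (17.1.6),
  Déf. (17.3.1).
* [StacksProject] The Stacks Project, Tag 02H6 (infinitesimal lifting criterion for smooth morphisms).
* [HarrisTaylorAMS2001] M. Harris, R. Taylor, *The Geometry and Cohomology of Some Simple Shimura Varieties*, Ann. of Math. Stud. 151 (2001),
  Lemma III.4.1 (p. 108) — the use: smoothness of the integral model at points of residue characteristic prime to `p`.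
-/

-- The cell's namespace `Summit.HodgeConjecture.HodgeConjecture.…` repeats `HodgeConjecture` (summit = sub-problem), which
-- `linter.dupNamespace` flags; the lakefile turns the linter off tree-wide (weak option), restated here so stand-alone elaboration is
-- warning-free.
set_option linter.dupNamespace false
set_option autoImplicit false

namespace Summit.HodgeConjecture.HodgeConjecture.Cruxes.HLiu418.F0P6dStubL4B5b

universe u

open CategoryTheory AlgebraicGeometry

/-- **Stub (5b), socket (b-0) «lifts where `p` is a unit, from smoothness over `S[1/p]`» — the text of
`F0P6dLubinTateFormalModuli.StubL4B5bStatement` with `LiftsWherePUnit` ∕ `ArtinianLiftsWhere` unfolded.**  For every morphism of schemes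
`ω : Z ⟶ S` and every `p : ℕ` with `ω ∣_ S.basicOpen p` smooth: for every Artinian local ring `A` in which `p` is a unit, every ideal
`J ≠ ⊤` with `𝔪_A · J = 0`, every `a : Spec A ⟶ S` and every `z₀ : Spec (A⧸J) ⟶ Z` with `z₀ ≫ ω = Spec(A ↠ A⧸J) ≫ a`, there is
`z : Spec A ⟶ Z` with `z ≫ ω = a` and `Spec(A ↠ A⧸J) ≫ z = z₀`.  Proof: ★ `liftsWherePUnit_of_smooth_restrict_basicOpen` (the point lands in
`S[1/p]` because `p ∈ Aˣ`; `J² = 0`; smooth ⇒ formally smooth for `ω ∣_ S[1/p]`).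
[cite: EGAIV4, Prop. (17.1.6) and Déf. (17.3.1)] [cite: StacksProject, Tag 02H6] [cite: HarrisTaylorAMS2001, Lemma III.4.1 (p. 108)] -/
theorem stubL4B5bStatement :
    ∀ (Z S : Scheme.{u}) (ω : Z ⟶ S) (p : ℕ), Smooth (ω ∣_ S.basicOpen ((p : ℕ) : Γ(S, ⊤))) →
      ∀ (A : Type u) [CommRing A] [IsArtinianRing A] [IsLocalRing A], IsUnit (p : A) → ∀ (J : Ideal A), J ≠ ⊤ →
        IsLocalRing.maximalIdeal A * J = ⊥ →
        ∀ (a : Spec (.of A) ⟶ S) (z₀ : Spec (.of (A ⧸ J)) ⟶ Z),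
          z₀ ≫ ω = Spec.map (CommRingCat.ofHom (Ideal.Quotient.mk J)) ≫ a →
          ∃ z : Spec (.of A) ⟶ Z, z ≫ ω = a ∧ Spec.map (CommRingCat.ofHom (Ideal.Quotient.mk J)) ≫ z = z₀ :=
  fun Z S ω p hω => Literature.AlgebraicGeometry.Morphisms.liftsWherePUnit_of_smooth_restrict_basicOpen Z S ω p hω

end Summit.HodgeConjecture.HodgeConjecture.Cruxes.HLiu418.F0P6dStubL4B5b
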